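import Literature.Probability.LatticeModels.KilledWalkGreen
import Literature.Probability.LatticeModels.KilledWalkHubFactorisation
import HarnessLib

/-!
# Green potentials of the edge-killed walk in a finite region of `ℤ²`

Topic `Literature/Probability/LatticeModels`; continuation of `KilledWalkLaplacian.lean`,
`KilledWalkGreen.lean` and `KilledWalkHubFactorisation.lean` (the simple random walk on `ℤ²` run
along the edges of a subgraph `Gr` and killed at its first step that is not a `Gr`-edge;
neighbour average `killedAvg Gr`, Green function `killedRegionGreen Gr S v y = G_S(v,y)` of a
finite region `S`, hitting probabilities `hitProb Gr Λ B`). For a source `ψ : ℤ² → ℝ` the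
**Green potential**

  `killedPotential Gr S ψ v = ∑_y G_S(v,y) · ψ y`

is the expected total source collected by the walk started at `v` before it leaves `S` or is
killed. Analytically it is the unique function vanishing off `S` solving the **Poisson equation**
`killedAvg Gr Φ - Φ = -ψ` on `S` (`Δ G_S(·,y) = -𝟙_y`; Lawler–Limic 2010, §4.6 and §6.2,
`f = G_A g`; Chelkak 2016, §2.3). Contents (everything proved; maximum principle only, no random
walk is used):

* `killedPotential` (a `finsum`; finite-sum forms `killedPotential_eq_sum`,
  `killedPotential_eq_sum_of_subset`, `killedPotential_eq_sum_of_forall_mem`), vanishing off the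
  region, linearity and monotonicity in the source, `killedPotential_one` (`= killedExitTime`);
* the Poisson equation `killedAvg_killedPotential_sub` / `killedPotential_eq_killedAvg_add`,
  harmonicity where the source vanishes, and **uniqueness** `eq_killedPotential_of_killedAvg_sub_eq`
  (a function vanishing off `S` is the potential of its source `F - killedAvg Gr F`: the Riesz
  decomposition with zero boundary values, `eq_killedPotential_sub_killedAvg`), and the
  **last-exit decomposition** `IsKilledHarmonicOn.eq_killedPotential_killedAvg_indicator`: a
  killed-harmonic function on `S` is, on `S`, the potential of its boundary flux
  `killedAvg Gr (Sᶜ.indicator h)` — a nonnegative source when `h ≥ 0` off `S` (harmonic measures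
  and Poisson kernels of the killed walk are Green potentials of nonnegative sources);
* for sources nonnegative on the region: nonnegativity, superharmonicity, `ψ ≤ Φ` on `S` and
  positivity at a positive source (`G_S(v,v) ≥ 1`), monotonicity in the region and in the graph,
  the bounds by a supersolution (`killedPotential_le_of_supersolution`), by the values on the
  support of the source (`killedPotential_le_of_le_on_support`) and by `sup ψ · killedExitTime`;
* the **two-region comparison** `killedPotential_le_add_mul_hitProb`: for `S₂ ⊆ S₁`,
  `Φ_{S₁} ≤ Φ_{S₂} + (sup_{S₁ ∖ S₂} Φ_{S₁}) · hitProb Gr S₁ (S₁ ∖ S₂)` everywhere (strong Markov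
  property at the exit time of `S₂`: the source collected afterwards is the potential `Φ_{S₁}` at
  the exit site, which lies in `S₁ ∖ S₂` with probability `hitProb Gr S₁ (S₁ ∖ S₂)`).

## References

* G. F. Lawler, V. Limic, *Random Walk: A Modern Introduction*, CUP (2010), §4.6 (Green's
  function of a finite set), §6.2 (Poisson equation `Δf = -g` on `A`, `f = 0` off `A`, solved by
  `f = G_A g`). [LawlerLimic2010]
* D. Chelkak, *Robust discrete complex analysis: a toolbox*, Ann. Probab. 44 (2016), §2.3
  (Green's function of a discrete domain, `[ΔG_Ω(·;u)](u) = -μ_u⁻¹`). [Chelkak2016]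
-/

noncomputable section

open scoped Classical

namespace Literature.Probability.LatticeModels

open Finset

variable {Gr : SimpleGraph (Site 2)}

/-! ### The Green potential of a source -/

/-- **The Green potential** of the source `ψ` for the edge-killed walk in the region `S`:
`killedPotential Gr S ψ v = ∑_y G_S(v,y) · ψ y`, the expected total source collected by the walk
started at `v`, run along `Gr` and killed at its first non-`Gr` step, before it leaves `S`
(Lawler–Limic 2010, §6.2, `G_A g`). A `finsum`: for finite `S` the summand vanishes for `y ∉ S`;
for infinite `S` the Green function is the junk value `0` and so is the potential.
[cite: LawlerLimic2010, §6.2] -/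
def killedPotential (Gr : SimpleGraph (Site 2)) (S : Set (Site 2)) (ψ : Site 2 → ℝ) (v : Site 2) : ℝ :=
  ∑ᶠ y, killedRegionGreen Gr S v y * ψ y

/-- For a finite `T ⊇ S` the potential is the finite sum `∑_{y ∈ T} G_S(v,y) ψ y`. [folklore] -/
theorem killedPotential_eq_sum_of_subset {S T : Set (Site 2)} (hT : T.Finite) (hST : S ⊆ T)
    (ψ : Site 2 → ℝ) (v : Site 2) :
    killedPotential Gr S ψ v = ∑ y ∈ hT.toFinset, killedRegionGreen Gr S v y * ψ y := by
  refine finsum_eq_sum_of_support_subset_of_finite _ (fun y hy => ?_) hT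
  by_contra hyT
  exact hy (show killedRegionGreen Gr S v y * ψ y = 0 by
    rw [killedRegionGreen_of_not_mem_right S v (fun h => hyT (hST h)), zero_mul])

/-- For finite `S` the potential is the finite sum `∑_{y ∈ S} G_S(v,y) ψ y`. [folklore] -/
theorem killedPotential_eq_sum {S : Set (Site 2)} (hS : S.Finite) (ψ : Site 2 → ℝ) (v : Site 2) :
    killedPotential Gr S ψ v = ∑ y ∈ hS.toFinset, killedRegionGreen Gr S v y * ψ y :=
  killedPotential_eq_sum_of_subset hS Set.Subset.rfl ψ v

/-- The potential as a function, for finite `S`. [folklore] -/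
theorem killedPotential_eq_fun_sum {S : Set (Site 2)} (hS : S.Finite) (ψ : Site 2 → ℝ) :
    killedPotential Gr S ψ = fun v => ∑ y ∈ hS.toFinset, killedRegionGreen Gr S v y * ψ y :=
  funext fun v => killedPotential_eq_sum hS ψ v

/-- If the source vanishes on `S` outside a finite set `B`, the potential is the sum over `B`. [folklore] -/
theorem killedPotential_eq_sum_of_forall_mem {S : Set (Site 2)} {ψ : Site 2 → ℝ} (B : Finset (Site 2))
    (hB : ∀ y ∈ S, ψ y ≠ 0 → y ∈ B) (v : Site 2) :
    killedPotential Gr S ψ v = ∑ y ∈ B, killedRegionGreen Gr S v y * ψ y := by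
  refine finsum_eq_sum_of_support_subset _ fun y hy => ?_
  rw [Finset.mem_coe]
  by_contra hyB
  refine hy (show killedRegionGreen Gr S v y * ψ y = 0 from ?_)
  by_cases hyS : y ∈ S
  · rw [show ψ y = 0 from not_not.1 fun h => hyB (hB y hyS h), mul_zero]
  · rw [killedRegionGreen_of_not_mem_right S v hyS, zero_mul]

/-- The potential of an infinite region is the junk value `0`. [folklore] -/
theorem killedPotential_of_infinite {S : Set (Site 2)} (hS : ¬ S.Finite) (ψ : Site 2 → ℝ) (v : Site 2) :
    killedPotential Gr S ψ v = 0 :=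
  finsum_eq_zero_of_forall_eq_zero fun y => by rw [killedRegionGreen_of_infinite hS, zero_mul]

/-- The potential vanishes off the region. [folklore] -/
theorem killedPotential_of_not_mem {S : Set (Site 2)} (ψ : Site 2 → ℝ) {v : Site 2} (hv : v ∉ S) :
    killedPotential Gr S ψ v = 0 :=
  finsum_eq_zero_of_forall_eq_zero fun y => by
    rw [killedRegionGreen_of_not_mem_left S hv y, zero_mul]

/-- The potential only depends on the values of the source on the region. [folklore] -/
theorem killedPotential_congr {S : Set (Site 2)} {ψ₁ ψ₂ : Site 2 → ℝ} (h : ∀ y ∈ S, ψ₁ y = ψ₂ y)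
    (v : Site 2) : killedPotential Gr S ψ₁ v = killedPotential Gr S ψ₂ v :=
  finsum_congr fun y => by
    by_cases hy : y ∈ S
    · rw [h y hy]
    · rw [killedRegionGreen_of_not_mem_right S v hy, zero_mul, zero_mul]

/-- The potential is additive in the source. [folklore] -/
theorem killedPotential_add {S : Set (Site 2)} (ψ₁ ψ₂ : Site 2 → ℝ) (v : Site 2) :
    killedPotential Gr S (ψ₁ + ψ₂) v = killedPotential Gr S ψ₁ v + killedPotential Gr S ψ₂ v := by
  by_cases hS : S.Finite
  · simp only [killedPotential_eq_sum hS, Pi.add_apply, mul_add, Finset.sum_add_distrib]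
  · simp only [killedPotential_of_infinite hS, add_zero]

/-- The potential is homogeneous in the source. [folklore] -/
theorem killedPotential_const_mul {S : Set (Site 2)} (c : ℝ) (ψ : Site 2 → ℝ) (v : Site 2) :
    killedPotential Gr S (fun y => c * ψ y) v = c * killedPotential Gr S ψ v := by
  by_cases hS : S.Finite
  · simp only [killedPotential_eq_sum hS, Finset.mul_sum]
    exact Finset.sum_congr rfl fun y _ => by ring
  · simp only [killedPotential_of_infinite hS, mul_zero]

/-- The potential is monotone in the source (compared on the region). [folklore] -/
theorem killedPotential_mono {S : Set (Site 2)} {ψ₁ ψ₂ : Site 2 → ℝ} (h : ∀ y ∈ S, ψ₁ y ≤ ψ₂ y)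
    (v : Site 2) : killedPotential Gr S ψ₁ v ≤ killedPotential Gr S ψ₂ v := by
  by_cases hS : S.Finite
  · rw [killedPotential_eq_sum hS, killedPotential_eq_sum hS]
    exact Finset.sum_le_sum fun y hy =>
      mul_le_mul_of_nonneg_left (h y (hS.mem_toFinset.1 hy)) (killedRegionGreen_nonneg S v y)
  · rw [killedPotential_of_infinite hS, killedPotential_of_infinite hS]

/-- The potential of the unit source is the exit-time function `T_S v = ∑_{y ∈ S} G_S(v,y)`. [folklore] -/
theorem killedPotential_one {S : Set (Site 2)} (v : Site 2) :
    killedPotential Gr S (fun _ => 1) v = killedExitTime Gr S v := by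
  by_cases hS : S.Finite
  · simp only [killedPotential_eq_sum hS, killedExitTime_eq hS, mul_one]
  · rw [killedPotential_of_infinite hS]; simp [killedExitTime, hS]

/-! ### The Poisson equation and uniqueness -/

/-- **The Poisson equation**: for finite `S` and `Φ = killedPotential Gr S ψ`, on `S`,
`killedAvg Gr Φ v - Φ v = -ψ v` (`Δ G_S(·,y) = -𝟙_y` summed against `ψ`; Lawler–Limic 2010,
§6.2; Chelkak 2016, §2.3). [cite: LawlerLimic2010, §6.2] -/
theorem killedAvg_killedPotential_sub {S : Set (Site 2)} (hS : S.Finite) (ψ : Site 2 → ℝ) :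
    ∀ v ∈ S, killedAvg Gr (killedPotential Gr S ψ) v - killedPotential Gr S ψ v = -ψ v := by
  rw [killedPotential_eq_fun_sum hS ψ]
  exact killedAvg_sum_killedRegionGreen_mul hS ψ

/-- The Poisson equation in mean-value form: `Φ v = killedAvg Gr Φ v + ψ v` on the finite region. [folklore] -/
theorem killedPotential_eq_killedAvg_add {S : Set (Site 2)} (hS : S.Finite) (ψ : Site 2 → ℝ) :
    ∀ v ∈ S, killedPotential Gr S ψ v = killedAvg Gr (killedPotential Gr S ψ) v + ψ v :=
  fun v hv => by linarith [killedAvg_killedPotential_sub (Gr := Gr) hS ψ v hv]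

/-- The potential is killed-harmonic on any set of sites of the (finite) region where the source
vanishes. [folklore] -/
theorem killedPotential_harmonicOn {S T : Set (Site 2)} (hS : S.Finite) {ψ : Site 2 → ℝ}
    (hT : ∀ v ∈ T, v ∈ S ∧ ψ v = 0) : IsKilledHarmonicOn Gr (killedPotential Gr S ψ) T :=
  fun v hv => by
    have key := killedAvg_killedPotential_sub (Gr := Gr) hS ψ v (hT v hv).1
    rw [(hT v hv).2, neg_zero, sub_eq_zero] at key
    exact key.symm

/-- **Uniqueness for the Poisson problem**: a function vanishing off the finite region `S` with
`killedAvg Gr F - F = -ψ` on `S` is the potential of `ψ` (the difference is killed-harmonic on `S`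
with zero boundary values; Lawler–Limic 2010, §6.2). [cite: LawlerLimic2010, §6.2] -/
theorem eq_killedPotential_of_killedAvg_sub_eq {S : Set (Site 2)} (hS : S.Finite) {F ψ : Site 2 → ℝ}
    (hF0 : ∀ w ∉ S, F w = 0) (hF : ∀ v ∈ S, killedAvg Gr F v - F v = -ψ v) (v : Site 2) :
    F v = killedPotential Gr S ψ v := by
  by_cases hv : v ∈ S
  · have hharm : IsKilledHarmonicOn Gr (F - killedPotential Gr S ψ) S := fun w hw => by
      rw [killedAvg_sub, Pi.sub_apply]
      linarith [hF w hw, killedAvg_killedPotential_sub (Gr := Gr) hS ψ w hw]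
    have key := hharm.eq_of_eq_boundary hS (isKilledHarmonicOn_zero S)
      (fun w hw => by rw [Pi.sub_apply, hF0 w hw.1, killedPotential_of_not_mem ψ hw.1, sub_zero]) v hv
    rw [Pi.sub_apply] at key
    linarith
  · rw [hF0 v hv, killedPotential_of_not_mem ψ hv]

/-- **Riesz decomposition with zero boundary values**: a function vanishing off the finite region
`S` is the potential of its own source `F - killedAvg Gr F`. [cite: LawlerLimic2010, §6.2] -/
theorem eq_killedPotential_sub_killedAvg {S : Set (Site 2)} (hS : S.Finite) {F : Site 2 → ℝ}
    (hF0 : ∀ w ∉ S, F w = 0) (v : Site 2) :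
    F v = killedPotential Gr S (fun y => F y - killedAvg Gr F y) v :=
  eq_killedPotential_of_killedAvg_sub_eq hS hF0 (fun v _ => by ring) v

/-- **A killed-harmonic function is the potential of its boundary flux** (last-exit
decomposition): if `h` is killed-harmonic on the finite region `S` then, on `S`,
`h = killedPotential Gr S (killedAvg Gr (Sᶜ.indicator h))`, i.e.
`h v = ∑_{y ∈ S} G_S(v,y) · ¼ ∑_{e : y + e ∉ S, Gr.Adj y (y + e)} h (y + e)` — the walk from `v`
leaves `S` alive along a `Gr`-edge `y → y + e` out of `S` after its last visit to `y`
(Lawler–Limic 2010, §6.2, `H_A(x,z) = ∑_y G_A(x,y) p(y,z)`); the source is nonnegative as soon as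
`h ≥ 0` off `S` (`killedAvg_indicator_compl_nonneg`). Proof: `S.indicator h` vanishes off `S` and
its source at `y ∈ S` is `h y - killedAvg (𝟙_S h) y = killedAvg (h - 𝟙_S h) y`. [cite: LawlerLimic2010, §6.2] -/
theorem IsKilledHarmonicOn.eq_killedPotential_killedAvg_indicator {S : Set (Site 2)} (hS : S.Finite)
    {h : Site 2 → ℝ} (H : IsKilledHarmonicOn Gr h S) :
    ∀ v ∈ S, h v = killedPotential Gr S (killedAvg Gr (Sᶜ.indicator h)) v := by
  intro v hv
  have key := eq_killedPotential_sub_killedAvg (Gr := Gr) hS (F := S.indicator h)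
    (fun w hw => Set.indicator_of_notMem hw h) v
  rw [Set.indicator_of_mem hv] at key
  rw [key]
  refine killedPotential_congr (fun y hy => ?_) v
  rw [Set.indicator_of_mem hy, H y hy]
  have hsplit : killedAvg Gr h y = killedAvg Gr (S.indicator h) y + killedAvg Gr (Sᶜ.indicator h) y := by
    rw [← killedAvg_add, Set.indicator_self_add_compl]
  linarith

/-- The boundary flux of a function nonnegative off `S` is a nonnegative source. [folklore] -/
theorem killedAvg_indicator_compl_nonneg {S : Set (Site 2)} {h : Site 2 → ℝ} (h0 : ∀ w ∉ S, 0 ≤ h w)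
    (y : Site 2) : 0 ≤ killedAvg Gr (Sᶜ.indicator h) y :=
  killedAvg_nonneg Gr fun _ _ => Set.indicator_nonneg (fun w hw => h0 w hw) _

/-! ### Nonnegative sources -/

/-- The potential of a source nonnegative on the region is nonnegative. [folklore] -/
theorem killedPotential_nonneg {S : Set (Site 2)} {ψ : Site 2 → ℝ} (hψ : ∀ y ∈ S, 0 ≤ ψ y)
    (v : Site 2) : 0 ≤ killedPotential Gr S ψ v :=
  finsum_nonneg fun y => by
    by_cases hy : y ∈ S
    · exact mul_nonneg (killedRegionGreen_nonneg S v y) (hψ y hy)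
    · rw [killedRegionGreen_of_not_mem_right S v hy, zero_mul]

/-- The potential of a nonnegative source is killed-superharmonic on the region. [folklore] -/
theorem killedPotential_superharmonicOn {S : Set (Site 2)} {ψ : Site 2 → ℝ} (hψ : ∀ y ∈ S, 0 ≤ ψ y) :
    IsKilledSuperharmonicOn Gr (killedPotential Gr S ψ) S := fun v hv => by
  by_cases hS : S.Finite
  · linarith [killedAvg_killedPotential_sub (Gr := Gr) hS ψ v hv, hψ v hv]
  · have h0 : killedPotential Gr S ψ = fun _ => 0 :=
      funext fun w => killedPotential_of_infinite hS ψ w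
    simp [h0]

/-- **The source is collected at least once**: `ψ v ≤ Φ v` on the finite region for a source
nonnegative on the region (`G_S(v,v) ≥ 1`). [folklore] -/
theorem le_killedPotential {S : Set (Site 2)} (hS : S.Finite) {ψ : Site 2 → ℝ}
    (hψ : ∀ y ∈ S, 0 ≤ ψ y) {v : Site 2} (hv : v ∈ S) : ψ v ≤ killedPotential Gr S ψ v := by
  rw [killedPotential_eq_sum hS]
  calc ψ v ≤ killedRegionGreen Gr S v v * ψ v :=
        le_mul_of_one_le_left (hψ v hv) (one_le_killedRegionGreen_diag hS hv)
    _ ≤ ∑ y ∈ hS.toFinset, killedRegionGreen Gr S v y * ψ y :=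
        Finset.single_le_sum (f := fun y => killedRegionGreen Gr S v y * ψ y)
          (fun y hy => mul_nonneg (killedRegionGreen_nonneg S v y) (hψ y (hS.mem_toFinset.1 hy)))
          (hS.mem_toFinset.2 hv)

/-- The potential of a source nonnegative on the finite region is positive at a site of the
region carrying a positive source. [folklore] -/
theorem killedPotential_pos_of_pos {S : Set (Site 2)} (hS : S.Finite) {ψ : Site 2 → ℝ}
    (hψ : ∀ y ∈ S, 0 ≤ ψ y) {v : Site 2} (hv : v ∈ S) (h : 0 < ψ v) :
    0 < killedPotential Gr S ψ v :=
  h.trans_le (le_killedPotential hS hψ hv)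

/-- **Upper bound by the exit time**: if `ψ ≤ C` on the region then `Φ ≤ C · T_S`
(`T_S = killedExitTime Gr S`, the potential of the unit source). [folklore] -/
theorem killedPotential_le_mul_killedExitTime {S : Set (Site 2)} {ψ : Site 2 → ℝ} {C : ℝ}
    (hψ : ∀ y ∈ S, ψ y ≤ C) (v : Site 2) : killedPotential Gr S ψ v ≤ C * killedExitTime Gr S v := by
  by_cases hS : S.Finite
  · rw [killedPotential_eq_sum hS, killedExitTime_eq hS, Finset.mul_sum]
    exact Finset.sum_le_sum fun y hy => by
      rw [mul_comm C]
      exact mul_le_mul_of_nonneg_left (hψ y (hS.mem_toFinset.1 hy)) (killedRegionGreen_nonneg S v y)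
  · rw [killedPotential_of_infinite hS]; simp [killedExitTime, hS]

/-- **Monotonicity in the region**: `S₂ ⊆ S₁` (finite) and a source nonnegative on `S₁` give
`Φ_{S₂} ≤ Φ_{S₁}` (termwise, `G_{S₂} ≤ G_{S₁}`). [cite: LawlerLimic2010, §4.6] -/
theorem killedPotential_mono_set {S₁ S₂ : Set (Site 2)} (hS₁ : S₁.Finite) (h₂₁ : S₂ ⊆ S₁)
    {ψ : Site 2 → ℝ} (hψ : ∀ y ∈ S₁, 0 ≤ ψ y) (v : Site 2) :
    killedPotential Gr S₂ ψ v ≤ killedPotential Gr S₁ ψ v := by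
  rw [killedPotential_eq_sum_of_subset hS₁ h₂₁, killedPotential_eq_sum hS₁]
  exact Finset.sum_le_sum fun y hy =>
    mul_le_mul_of_nonneg_right (killedRegionGreen_mono_set hS₁ h₂₁ v y) (hψ y (hS₁.mem_toFinset.1 hy))

/-- **Monotonicity in the graph**: `Gr ≤ Gr'` (more edges, fewer killings) gives `Φ^{Gr} ≤ Φ^{Gr'}`
for a source nonnegative on the region. [folklore] -/
theorem killedPotential_mono_graph {Gr Gr' : SimpleGraph (Site 2)} (hle : Gr ≤ Gr') {S : Set (Site 2)}
    {ψ : Site 2 → ℝ} (hψ : ∀ y ∈ S, 0 ≤ ψ y) (v : Site 2) :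
    killedPotential Gr S ψ v ≤ killedPotential Gr' S ψ v := by
  by_cases hS : S.Finite
  · rw [killedPotential_eq_sum hS, killedPotential_eq_sum hS]
    exact Finset.sum_le_sum fun y hy =>
      mul_le_mul_of_nonneg_right (killedRegionGreen_mono_graph hle S v y) (hψ y (hS.mem_toFinset.1 hy))
  · rw [killedPotential_of_infinite hS, killedPotential_of_infinite hS]

/-! ### Comparison: supersolutions, the support of the source, and two regions -/

/-- **A supersolution dominates the potential.** On a finite region `S`: if `φ ≥ 0` on the outer
boundary of `S` for the killed walk and `killedAvg Gr φ v + ψ v ≤ φ v` for `v ∈ S`, then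
`killedPotential Gr S ψ ≤ φ` on `S` — the difference `Φ - φ` is killed-subharmonic on `S` and
`≤ 0` on the outer boundary, where `Φ` vanishes (maximum principle). [folklore] -/
theorem killedPotential_le_of_supersolution {S : Set (Site 2)} (hS : S.Finite) {ψ φ : Site 2 → ℝ}
    (hφ0 : ∀ w ∈ killedOuterBoundary Gr S, 0 ≤ φ w)
    (hφ : ∀ v ∈ S, killedAvg Gr φ v + ψ v ≤ φ v) :
    ∀ v ∈ S, killedPotential Gr S ψ v ≤ φ v := by
  have hsub : IsKilledSubharmonicOn Gr (killedPotential Gr S ψ - φ) S := fun v hv => by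
    rw [killedAvg_sub, Pi.sub_apply]
    linarith [killedAvg_killedPotential_sub (Gr := Gr) hS ψ v hv, hφ v hv]
  intro v hv
  have key := hsub.le_of_forall_boundary_le hS (M := 0) le_rfl (fun w hw => by
    rw [Pi.sub_apply, killedPotential_of_not_mem ψ hw.1, zero_sub, neg_nonpos]
    exact hφ0 w hw) v hv
  rwa [Pi.sub_apply, sub_nonpos] at key

/-- **The potential is controlled by its values on the support of the source** (maximum principle
off the support): for finite `S` and `0 ≤ M`, if `Φ w ≤ M` at every site `w ∈ S` with `ψ w ≠ 0`,
then `Φ ≤ M` everywhere (`Φ` is killed-harmonic on `S ∩ {ψ = 0}` and vanishes off `S`). [folklore] -/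
theorem killedPotential_le_of_le_on_support {S : Set (Site 2)} (hS : S.Finite) {ψ : Site 2 → ℝ}
    {M : ℝ} (hM0 : 0 ≤ M) (hM : ∀ w ∈ S, ψ w ≠ 0 → killedPotential Gr S ψ w ≤ M) (v : Site 2) :
    killedPotential Gr S ψ v ≤ M := by
  by_cases hv : v ∈ S ∧ ψ v = 0
  · have hharm : IsKilledHarmonicOn Gr (killedPotential Gr S ψ) {w | w ∈ S ∧ ψ w = 0} :=
      killedPotential_harmonicOn hS fun w hw => hw
    refine hharm.le_of_forall_boundary_le (hS.subset fun w hw => hw.1) hM0 (fun w hw => ?_) v hv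
    by_cases hwS : w ∈ S
    · exact hM w hwS fun h0 => hw.1 ⟨hwS, h0⟩
    · rw [killedPotential_of_not_mem ψ hwS]; exact hM0
  · by_cases hvS : v ∈ S
    · exact hM v hvS fun h0 => hv ⟨hvS, h0⟩
    · rw [killedPotential_of_not_mem ψ hvS]; exact hM0

/-- **Comparison of the potentials in two regions** (strong Markov property at the exit time of the
smaller region). Let `S₂ ⊆ S₁` with `S₁` finite and `killedPotential Gr S₁ ψ ≤ M` on `S₁ ∖ S₂`.
Then everywhere `Φ_{S₁} ≤ Φ_{S₂} + M · hitProb Gr S₁ (S₁ ∖ S₂)`: the source collected after the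
walk leaves `S₂` is the potential `Φ_{S₁}` at the exit site, which lies in `S₁ ∖ S₂` — alive —
with probability `hitProb Gr S₁ (S₁ ∖ S₂)`. Analytically: `Φ_{S₁} - Φ_{S₂}` (same source) and
`M · hitProb` are killed-harmonic on `S₂ = S₁ ∖ (S₁ ∖ S₂)`; on the outer boundary of `S₂` a site
lies in `S₁ ∖ S₂` (where `Φ_{S₂} = 0`, `hitProb = 1`, `Φ_{S₁} ≤ M`) or off `S₁` (where all three
vanish); comparison principle. No sign condition on `ψ` or `M` is needed. [folklore] -/
theorem killedPotential_le_add_mul_hitProb_of_le_on_sdiff {S₁ S₂ : Set (Site 2)} (hS₁ : S₁.Finite)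
    (h₂₁ : S₂ ⊆ S₁) (ψ : Site 2 → ℝ) {M : ℝ}
    (hM : ∀ w ∈ S₁ \ S₂, killedPotential Gr S₁ ψ w ≤ M) (v : Site 2) :
    killedPotential Gr S₁ ψ v ≤ killedPotential Gr S₂ ψ v + M * hitProb Gr S₁ (S₁ \ S₂) v := by
  have hS₂ : S₂.Finite := hS₁.subset h₂₁
  have hreg : S₁ \ (S₁ \ S₂) = S₂ := Set.sdiff_sdiff_cancel_left h₂₁
  -- the inequality off `S₂`
  have hoff : ∀ w ∉ S₂, killedPotential Gr S₁ ψ w ≤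
      killedPotential Gr S₂ ψ w + M * hitProb Gr S₁ (S₁ \ S₂) w := by
    intro w hw
    rw [killedPotential_of_not_mem ψ hw, zero_add, hitProb_of_not_mem (by rw [hreg]; exact hw)]
    by_cases hw₁ : w ∈ S₁
    · rw [if_pos ⟨hw₁, hw⟩, mul_one]; exact hM w ⟨hw₁, hw⟩
    · rw [if_neg (fun h => hw₁ h.1), mul_zero, killedPotential_of_not_mem ψ hw₁]
  by_cases hv : v ∈ S₂
  swap
  · exact hoff v hv
  -- on `S₂`: comparison principle for two killed-harmonic functions
  have h1 : IsKilledHarmonicOn Gr (killedPotential Gr S₁ ψ - killedPotential Gr S₂ ψ) S₂ :=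
    fun w hw => by
      rw [killedAvg_sub, Pi.sub_apply]
      linarith [killedAvg_killedPotential_sub (Gr := Gr) hS₁ ψ w (h₂₁ hw),
        killedAvg_killedPotential_sub (Gr := Gr) hS₂ ψ w hw]
  have h2 : IsKilledHarmonicOn Gr (fun w => M * hitProb Gr S₁ (S₁ \ S₂) w) S₂ := by
    have key := (hitProb_harmonicOn (Gr := Gr) (B := S₁ \ S₂) hS₁).const_mul M
    rwa [hreg] at key
  have key := le_of_killedSub_killedSuper_of_boundary hS₂ h1.subharmonicOn h2.superharmonicOn
    (fun w hw => by rw [Pi.sub_apply, sub_le_iff_le_add']; exact hoff w hw.1) v hv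
  rwa [Pi.sub_apply, sub_le_iff_le_add'] at key

/-- **Comparison of the potentials in two regions**, with the bound on the larger potential taken
over the whole larger region: for `S₂ ⊆ S₁` (finite) and `killedPotential Gr S₁ ψ ≤ M` on `S₁`,
`Φ_{S₁} ≤ Φ_{S₂} + M · hitProb Gr S₁ (S₁ ∖ S₂)` everywhere. [folklore] -/
theorem killedPotential_le_add_mul_hitProb {S₁ S₂ : Set (Site 2)} (hS₁ : S₁.Finite) (h₂₁ : S₂ ⊆ S₁)
    (ψ : Site 2 → ℝ) {M : ℝ} (hM : ∀ w ∈ S₁, killedPotential Gr S₁ ψ w ≤ M) (v : Site 2) :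
    killedPotential Gr S₁ ψ v ≤ killedPotential Gr S₂ ψ v + M * hitProb Gr S₁ (S₁ \ S₂) v :=
  killedPotential_le_add_mul_hitProb_of_le_on_sdiff hS₁ h₂₁ ψ (fun w hw => hM w hw.1) v

/-- **Two-sided comparison of two regions** for a source nonnegative on the larger region:
`Φ_{S₂} ≤ Φ_{S₁} ≤ Φ_{S₂} + M · hitProb Gr S₁ (S₁ ∖ S₂)`. [folklore] -/
theorem killedPotential_mem_Icc_of_subset {S₁ S₂ : Set (Site 2)} (hS₁ : S₁.Finite) (h₂₁ : S₂ ⊆ S₁)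
    {ψ : Site 2 → ℝ} (hψ : ∀ y ∈ S₁, 0 ≤ ψ y) {M : ℝ}
    (hM : ∀ w ∈ S₁ \ S₂, killedPotential Gr S₁ ψ w ≤ M) (v : Site 2) :
    killedPotential Gr S₂ ψ v ≤ killedPotential Gr S₁ ψ v ∧
      killedPotential Gr S₁ ψ v ≤ killedPotential Gr S₂ ψ v + M * hitProb Gr S₁ (S₁ \ S₂) v :=
  ⟨killedPotential_mono_set hS₁ h₂₁ hψ v,
    killedPotential_le_add_mul_hitProb_of_le_on_sdiff hS₁ h₂₁ ψ hM v⟩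

end Literature.Probability.LatticeModels
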